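import Summits.HodgeConjecture.HodgeConjecture.Theorems.LinearSystemTorelliMiddleDivisorSupportFourfoldStubConnectedWeakDescent
import Summits.HodgeConjecture.HodgeConjecture.Theorems.LinearSystemTorelliMiddleDivisorSupportFourfoldOfLineResidue
import Literature.AlgebraicGeometry.FundamentalGroup.FiniteEtaleQbarWeakDescent
import HarnessLib

/-!
# Crux stmt-HodgeConjecture-2409, line `IdeatorFiveSketch`: stub C2' `stub_connectedWeakDescentQbar` PROVED

Helper file (theorems only; `--supports stmt-HodgeConjecture-2409`) for the registered skeleton
`Cruxes/MiddleDivisorSupportFourfold/Lines/IdeatorFiveSketch.lean` (v8, lead c9) of the crux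
`LinearSystemTorelli.MiddleDivisorSupportFourfold`.  It proves the registered stub C2'
`stub_connectedWeakDescentQbar` — CONNECTED weak descent of finite étale covers along `ℚ̄ ⊂ ℂ`
(a finite étale cover `g : S' → S₀ ⊗_σ ℂ` of the complexification of a smooth irreducible
quasi-projective `ℚ̄`-scheme, with irreducible total space and connected complex points, is
homeomorphic OVER `S(ℂ)` to the complexification of a finite étale cover `g₀ : S''₀ → S₀` defined
over `ℚ̄`) — verbatim, by name and signature.

Proof: the tree's `FundamentalGroup.finiteEtaleCover_weakDescent`
(`Literature/AlgebraicGeometry/FundamentalGroup/FiniteEtaleQbarWeakDescent.lean`, p125641,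
2026-08-16T20:45Z) is the UNRESTRICTED weak descent — for every algebraically closed `K ⊆ ℂ` and
every finite étale cover, by spreading the cover out over a smooth affine `K`-variety
(`Limits.exists_finite_etale_spread_smooth`), specialising at a `K`-point, and transporting slices
of the covering map `X'(ℂ) → S₀(ℂ) × U(ℂ)` along a path in the path-connected `U(ℂ)`; the
connected form drops the two extra hypotheses
(`linearSystemTorelli_connectedWeakDescent_of_weakDescent`, p124440).  With this the named fact C
`FundamentalGroup.riemannExistence_qbarDescent_of_finiteIndex` consumed by stub B follows from
Riemann's existence theorem over `ℂ` (C1, `FundamentalGroup.riemannExistence_finiteCovering`) ALONE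
(`linearSystemTorelli_riemannExistence_qbarDescent_of_finiteIndex_of_riemannExistence`), and the
kernel-checked residue of the whole line (lead c7's
`linearSystemTorelli_middleDivisorSupportFourfold_of_lineResidue`, p124621, FOUR debts) loses its
weak-descent hypothesis: `linearSystemTorelli_middleDivisorSupportFourfold_of_lineResidue_of_weakDescent`
— crux ⟸ stmt-11597 ∧ stmt-11595 ∧ stmt-11596 modulo exactly THREE classical debts (BKU, Riemann
existence over `ℂ`, Deligne's partie fixe), the last one stated as the route crux
`LinearSystemTorelli.DeligneGlobalInvariantCycles` (stmt-HodgeConjecture-16363) BY NAME, as in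
skeleton v8/v9.

## References

* [SGA1] A. Grothendieck, M. Raynaud, SGA 1 (arXiv:math/0206203), Exp. XIII §4 (Cor. 4.4–Prop. 4.6,
  pp. 421–422); Exp. XII Thm. 5.1 (p. 333).
* [Voisin2007HodgeLoci] C. Voisin, Hodge loci and absolute Hodge classes, Compositio Math. 143
  (2007), §3, proof of Prop. 0.7.
-/

noncomputable section

-- every declaration of this problem lives in `Summit.HodgeConjecture.HodgeConjecture.…`
set_option linter.dupNamespace false

open CategoryTheory AlgebraicGeometry
open _root_.Topology

namespace Summit.HodgeConjecture.HodgeConjecture.Theorems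

open Literature.AlgebraicGeometry Literature.AlgebraicGeometry.Motives
open Literature.AlgebraicGeometry.HodgeTheory Literature.AlgebraicGeometry.FundamentalGroup

/-- **Weak descent of finite étale covers along `ℚ̄ ⊂ ℂ`, unrestricted form** (the binder
`hDescent` of the tree's
`FundamentalGroup.riemannExistence_qbarDescent_of_finiteIndex_of_riemannExistence_of_weakDescent`,
p121703, verbatim): every finite étale cover `g : S' → S₀ ⊗_σ ℂ` of the complexification of a
smooth irreducible quasi-projective `ℚ̄`-scheme `S₀` is homeomorphic OVER `S(ℂ)` to the
complexification of a finite étale cover `g₀ : S''₀ → S₀` defined over `ℚ̄`.  This is the tree's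
`FundamentalGroup.finiteEtaleCover_weakDescent` (p125641) at `K = ℚ̄`.
[cite: SGA1, Exp. XIII §4 (Cor. 4.4–Prop. 4.6, pp. 421–422)] [cite: Voisin2007HodgeLoci, §3] -/
theorem linearSystemTorelli_weakDescentQbar :
    ∀ (σ : AlgebraicClosure ℚ →+* ℂ) (S₀ : SchemeOver (AlgebraicClosure ℚ)),
      IsQuasiProjectiveOver S₀ → IrreducibleSpace S₀.left → AlgebraicGeometry.Smooth S₀.hom →
      ∀ ⦃S' : SchemeOver ℂ⦄ (g : S' ⟶ (baseChangeHom σ).obj S₀),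
        IsFinite g.left → Etale g.left →
        ∃ (S''₀ : SchemeOver (AlgebraicClosure ℚ)) (g₀ : S''₀ ⟶ S₀)
          (Ψ : ComplexPoints ((baseChangeHom σ).obj S''₀) ≃ₜ ComplexPoints S'),
          IsFinite g₀.left ∧ Etale g₀.left ∧
            ∀ z, AlgPoints.map g (Ψ z) = AlgPoints.map ((baseChangeHom σ).map g₀) z :=
  fun σ S₀ hqp hirr hsm _ g hfin het ↦ finiteEtaleCover_weakDescent σ S₀ hqp hirr hsm g hfin het

/-- **Stub C2' of skeleton v8 (line `IdeatorFiveSketch`, crux stmt-HodgeConjecture-2409), PROVED: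
CONNECTED weak descent of finite étale covers along `ℚ̄ ⊂ ℂ`.**  A finite étale cover
`g : S' → S₀ ⊗_σ ℂ` of the complexification of a smooth irreducible quasi-projective `ℚ̄`-scheme,
with irreducible total space and connected complex points, is homeomorphic OVER `S(ℂ)` to the
complexification of a finite étale cover `g₀ : S''₀ → S₀` defined over `ℚ̄` (the consumed part of
SGA1 XIII Prop. 4.6).  From the unrestricted weak descent (`linearSystemTorelli_weakDescentQbar`,
i.e. the tree's `finiteEtaleCover_weakDescent`) by dropping the two extra hypotheses
(`linearSystemTorelli_connectedWeakDescent_of_weakDescent`).  Registered stub, verbatim signature.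
[cite: SGA1, Exp. XIII §4 (Cor. 4.4–Prop. 4.6, pp. 421–422)] [cite: Voisin2007HodgeLoci, §3] -/
theorem stub_connectedWeakDescentQbar :
    ∀ (σ : AlgebraicClosure ℚ →+* ℂ) (S₀ : SchemeOver (AlgebraicClosure ℚ)),
      IsQuasiProjectiveOver S₀ → IrreducibleSpace S₀.left → AlgebraicGeometry.Smooth S₀.hom →
      ∀ ⦃S' : SchemeOver ℂ⦄ (g : S' ⟶ (baseChangeHom σ).obj S₀),
        IsFinite g.left → Etale g.left → IrreducibleSpace S'.left →
        ConnectedSpace (ComplexPoints S') →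
        ∃ (S''₀ : SchemeOver (AlgebraicClosure ℚ)) (g₀ : S''₀ ⟶ S₀)
          (Ψ : ComplexPoints ((baseChangeHom σ).obj S''₀) ≃ₜ ComplexPoints S'),
          IsFinite g₀.left ∧ Etale g₀.left ∧
            ∀ z, AlgPoints.map g (Ψ z) = AlgPoints.map ((baseChangeHom σ).map g₀) z :=
  linearSystemTorelli_connectedWeakDescent_of_weakDescent linearSystemTorelli_weakDescentQbar

/-- **The named fact C from Riemann's existence theorem over `ℂ` ALONE.**  With weak descent
proved (`linearSystemTorelli_weakDescentQbar`), the named fact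
`FundamentalGroup.riemannExistence_qbarDescent_of_finiteIndex` (Riemann existence with `ℚ̄`-descent
in the `π₁`/finite-index shape consumed by stub B, p119525) follows from Riemann's existence theorem
over `ℂ` in covering form (C1, the named fact `FundamentalGroup.riemannExistence_finiteCovering`,
SGA1 XII Thm. 5.1) and nothing else, by the tree's
`riemannExistence_qbarDescent_of_finiteIndex_of_riemannExistence_of_weakDescent` (p121703:
classification of coverings via the normal core, integrality and quasi-projectivity of the cover,
all proved).  So the line's covering debt is now exactly C1.
[cite: SGA1, Exp. XII Thm. 5.1 (p. 333) and Exp. XIII Prop. 4.6 (pp. 421–422)]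
[cite: HatcherAT2002, §1.3 Thm. 1.38 with Prop. 1.36 and Prop. 1.32] -/
theorem linearSystemTorelli_riemannExistence_qbarDescent_of_finiteIndex_of_riemannExistence
    (hRiemann : Literature.AlgebraicGeometry.FundamentalGroup.riemannExistence_finiteCovering) :
    Literature.AlgebraicGeometry.FundamentalGroup.riemannExistence_qbarDescent_of_finiteIndex :=
  riemannExistence_qbarDescent_of_finiteIndex_of_riemannExistence_of_weakDescent hRiemann
    linearSystemTorelli_weakDescentQbar

/-- **stmt-2409 ⟸ route `PeriodDeficiency` modulo THREE classical debts** (kernel-checked form of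
skeleton v9 of line `IdeatorFiveSketch` with stub A replaced by its landed reduction p119481 and
stub C2' by its proof): the crux `MiddleDivisorSupportFourfold` follows from
`PeriodDeficiency.ClassicalGeometricVHS` (stmt-11597), `PeriodDeficiency.QbarGenericIsHodgeGeneric`
(stmt-11595) and `PeriodDeficiency.HodgeConjectureQbar` (stmt-11596), modulo the named facts
`bku_finite_monodromyOrbit_of_isHodgeGenericIn` (BKU), `FundamentalGroup.riemannExistence_finiteCovering`
(SGA1 XII 5.1) and the route crux `LinearSystemTorelli.DeligneGlobalInvariantCycles`
(stmt-HodgeConjecture-16363 = Deligne's partie fixe, Hodge II 4.1.1) — lead c7's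
`linearSystemTorelli_middleDivisorSupportFourfold_of_lineResidue` (p124621) with its connected
weak-descent hypothesis DISCHARGED by `stub_connectedWeakDescentQbar`.
[cite: Voisin2007HodgeLoci, §3, proof of Prop. 0.7] [cite: SGA1, Exp. XII Thm. 5.1 and Exp. XIII Prop. 4.6]
[cite: DeligneHodgeII1971, Thm. 4.1.1] -/
theorem linearSystemTorelli_middleDivisorSupportFourfold_of_lineResidue_of_weakDescent :
    Summit.HodgeConjecture.HodgeConjecture.Theses.PeriodDeficiency.ClassicalGeometricVHS →
    Summit.HodgeConjecture.HodgeConjecture.Theses.PeriodDeficiency.QbarGenericIsHodgeGeneric →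
    Summit.HodgeConjecture.HodgeConjecture.Theses.PeriodDeficiency.HodgeConjectureQbar →
    Literature.AlgebraicGeometry.HodgeTheory.bku_finite_monodromyOrbit_of_isHodgeGenericIn →
    Literature.AlgebraicGeometry.FundamentalGroup.riemannExistence_finiteCovering →
    Summit.HodgeConjecture.HodgeConjecture.Theses.LinearSystemTorelli.DeligneGlobalInvariantCycles →
    Summit.HodgeConjecture.HodgeConjecture.Theses.LinearSystemTorelli.MiddleDivisorSupportFourfold :=
  fun hC hG hQ hB hR hD ↦
    linearSystemTorelli_middleDivisorSupportFourfold_of_lineResidue hC hG hQ hB hR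
      stub_connectedWeakDescentQbar hD

end Summit.HodgeConjecture.HodgeConjecture.Theorems

end
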